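import Literature.MathematicalPhysics.QuantumFieldTheory.Balaban1983to89.B16Ineq382Cases

/-!
# `Balaban1983to89.B15TreeGaugeT0Stokes` — T. Bałaban, *Large field renormalization. I. The basic step of the 𝐑 operation*, Commun. Math. Phys. **122** (1989) 175–202 [Balaban1989LargeFieldI], p. 196 (the tree gauge `T₀` on `𝐁₀`): the Stokes estimates for loops through TWO consecutive annuli of the chain — the interleaving lemma for staircase contours and the comparison of the `T₀`-path into an inner layer with the contour of the merged annulus (PART 5 of this unit's transport reading)

statement-level skeleton of published theorems with citation tags; proofs where landed; nothing here is a claim about the Yang–Mills mass gap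

PDF held: `paper:balaban1989-cmp122-large-field-i` (journal page = PDF page + 174; p. 196 = PDF p. 22, text layer re-read for
this file); [Balaban1989LargeFieldII] = `paper:balaban1989-cmp122-large-field-ii` (p. 382 = PDF p. 28).

WHAT IS REPRODUCED (mega-formalization `lit-balaban`, HOME `run/shared/lean/pub/lit-balaban/`, Phase-2 seat p26, generation 5;
SKELETON row **B15.Claim@196** (*"The regularity conditions for V″, V₀, and the gauge fixing for V′ introduce restrictions on
this field. We can prove that it satisfies |V′ − 1| < O(1)M²NR_k⁴ε_k on 𝐁₀"*, p. 196; NO PROOF IS PRINTED), served by PART 6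
`B15Claim196T0`; referee ref-5).  The mechanism is that of [Balaban1989LargeFieldII] p. 382 / Lemma 1 of [14] (*"the same
reasoning as in the proof of Lemma 1 [14]"*): in a tree gauge a bond variable is the holonomy of the loop closed through the
tree, bounded by (number of plaquettes of a spanning surface) × ε.  PARTS 1–3 of this unit (`B16Ineq382Stokes`, `…Cases`,
`…TreeGauge`) span the loops inside ONE annulus `P₁∖P₂`; this PART spans the loops that the `T₀`-paths into the NEXT layer
create, i.e. it compares, for a site `x′` of the inner layer `P₂∖P₃` of two consecutive pairs `(P₁,P₂)`, `(P₂,P₃)`, the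
`T₀`-path `treeWord (y′ − y) ∪ Γ^{P₂}_{y′,x′}` (corner `y` of `P₁` → corner `y′` of `P₂` through the tree of `P₁∖P₂` and the
external bond of `P₂`, then the contour of the pair `(P₂,P₃)`) with the contour `Γ^{P₁}_{y,x′}` of the MERGED pair `(P₁,P₃)`.

THE PROOF (this seat's; all words on the `ℤ^{n+3}` carriers of PARTS 1–3).  §1 ratio bookkeeping: `hol_replace_ratio` /
`norm_replace_le` (replacing a sub-word with the same end points changes the transport by a conjugate of the local ratio),
`norm_ratio_trans`, and the elementary swap `hol_swap_eq_wideLadder` (`w ∪ [b e_κ]` versus `[b e_κ] ∪ w` is PART 1's wide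
ladder = the strip swept by `w`) with its conjugated form `hol_conj_seg_ratio`.  §2 the **INTERLEAVING LEMMA**
`norm_hol_tw_append_tw_le`: for direction lists `K` without repetition and vectors `a, b ≥ 0` with entries `≤ W`, the
staircases `tw K a ∪ tw K b` and `tw K (a + b)` from `p` differ in transport by `‖·‖ ≤ |K|²W²ε` whenever every site of the order
box `[p, p + (a+b)|_K]` is a site of the plaquette-small region (induction on `K`: one wide ladder per direction).  §3 word
identities for the usual contours (`seg_add_of_nonneg`, `treeWord_add_zsmul_e0`, `restrict_finRange_reverse`).  §4 the
**TWO-LEVEL COMPARISON, case `x′₁ ≦ a`** (`norm_levelChange_usual_le`): for `Geom lo hi lo′ hi′ τ`, `Geom lo′ hi′ lo″ hi″ τ`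
(common threshold), sides `≤ W + 1`, a `U1`-valued `V` with `ε`-small plaquettes on the merged annulus `P₁∖P₃` and `x′ ∈
P₂∖P₃` with `x′₁ ≦ a`: `‖V(treeWord(lo′ − lo) ∪ Γ^{P₂}_{x′}) · V(Γ^{P₁}_{x′})⁻¹ − 1‖ ≤ d²W²ε` — both contours are usual; after
splitting off the common last `1`-segment the two staircases live in the slab `z₁ ≦ a′₁` (which misses `P₃`) and the
interleaving lemma applies.  The case `x′₁ > a` (both detours) and the combined statement `norm_levelChange_sub_one_le` are
PART 5b (`B15TreeGaugeT0LevelChange`).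

HONEST SCOPE.  Model = PARTS 1–3's: one unit lattice `ℤ^{n+3}` (`d = n + 3 ≥ 3`), `U1 𝔸`-valued bond fields (`⊇ U(N)`,
operator norm), `≤`-hypotheses; the constant `(d² + 2)W²` is this proof's (the print states no proof and no constant beyond
`O(1)`).  Every declaration is a definition-free proved lemma of lattice combinatorics / normed-group estimates; nothing of
[IV]/[V] is asserted.  Unit `lit-balaban-p26` (literature-prover-lit-balaban-p26-g5-0).
-/

noncomputable section

open scoped BigOperators

namespace Literature.MathematicalPhysics.QuantumFieldTheory.Balaban1983to89.B16Ineq382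

open B7Prop1Explicit B8Lemma1NonAbelian B15TreeGauge196

variable {d : ℕ}

/-! ## §1 Ratios of transports: replacing a sub-word, transitivity, the elementary swap -/

section Ratio

variable {G : Type*} [Group G]

/-- Replacing a sub-word `u` by `u′` with the same end points: the ratio of the transports along `w₁ ∪ u ∪ w₂` and
`w₁ ∪ u′ ∪ w₂` is the conjugate by `V(w₁)` of the local ratio `V(u)V(u′)⁻¹`. [cite: Balaban1989LargeFieldII, p.382] -/
theorem hol_replace_ratio (V : Site d → Fin d → G) (p : Site d) (w₁ u u' w₂ : List (Letter d)) (h : disp u = disp u') :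
    hol V p (w₁ ++ u ++ w₂) * (hol V p (w₁ ++ u' ++ w₂))⁻¹ =
      hol V p w₁ * (hol V (p + disp w₁) u * (hol V (p + disp w₁) u')⁻¹) * (hol V p w₁)⁻¹ := by
  simp only [hol_append, disp_append, h]
  group

/-- **The elementary swap is a wide ladder**: `V(w ∪ [b e_κ]) · V([b e_κ] ∪ w)⁻¹ = V(wideLadder w κ b)` — the two paths
bound the strip swept by `w` moved `b` steps in direction `κ` (PART 1). [cite: Balaban1989LargeFieldII, p.382] -/
theorem hol_swap_eq_wideLadder (V : Site d → Fin d → G) (q : Site d) (w : List (Letter d)) (κ : Fin d) (b : ℕ) :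
    hol V q (w ++ seg κ (b : ℤ)) * (hol V q (seg κ (b : ℤ) ++ w))⁻¹ = hol V q (wideLadder w κ b) := by
  rw [hol_wideLadder, hol_append, hol_append, disp_seg]
  group

/-- **A path conjugated by a segment**: `V(u) · V([δ e_ν] ∪ u ∪ [−δ e_ν])⁻¹ = V(wideLadder u ν δ)` — the path `u` against the
same path moved `δ` steps in direction `ν` and joined back by the two segments. [cite: Balaban1989LargeFieldII, p.382] -/
theorem hol_conj_seg_ratio (V : Site d → Fin d → G) (r : Site d) (u : List (Letter d)) (ν : Fin d) (δ : ℕ) :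
    hol V r u * (hol V r (seg ν (δ : ℤ) ++ u ++ seg ν (-(δ : ℤ))))⁻¹ = hol V r (wideLadder u ν δ) := by
  have hrev : hol V (r + ((δ : ℤ) • e ν + disp u)) (seg ν (-(δ : ℤ))) = (hol V (r + disp u) (seg ν (δ : ℤ)))⁻¹ := by
    rw [← revWord_seg]
    exact hol_revWord' V _ _ (by rw [disp_seg]; abel)
  rw [hol_wideLadder, hol_append, hol_append, disp_append, disp_seg, hrev]
  group

variable {𝔸 : Type*} [NormedRing 𝔸] [NormOneClass 𝔸]
variable {A : Set (Site d)} {V : Site d → Fin d → 𝔸ˣ} {ε : ℝ}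

/-- **Sub-word replacement, estimate**: the deviation of the ratio is that of the local ratio (conjugation by a `U1` element
does not increase `‖· − 1‖`). [cite: Balaban1989LargeFieldII, p.382] -/
theorem norm_replace_le (hV : ∀ x κ, V x κ ∈ U1 𝔸) {p : Site d} {w₁ u u' w₂ : List (Letter d)} (h : disp u = disp u')
    {δ : ℝ} (hδ : ‖((hol V (p + disp w₁) u * (hol V (p + disp w₁) u')⁻¹ : 𝔸ˣ) : 𝔸) - 1‖ ≤ δ) :
    ‖((hol V p (w₁ ++ u ++ w₂) * (hol V p (w₁ ++ u' ++ w₂))⁻¹ : 𝔸ˣ) : 𝔸) - 1‖ ≤ δ := by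
  rw [hol_replace_ratio V p w₁ u u' w₂ h, Units.val_mul, Units.val_mul]
  exact (norm_units_conj_sub_one_le (hol_mem hV _ _) _).trans hδ

/-- **Transitivity of ratio estimates** (chaining the surface pieces of a Stokes bound): `‖XZ⁻¹ − 1‖ ≤ ‖XY⁻¹ − 1‖ +
‖YZ⁻¹ − 1‖` in `U1`. [cite: Balaban1989LargeFieldII, p.382] -/
theorem norm_ratio_trans {X Y Z : 𝔸ˣ} (hX : X ∈ U1 𝔸) (hY : Y ∈ U1 𝔸) {δ₁ δ₂ : ℝ}
    (h₁ : ‖((X * Y⁻¹ : 𝔸ˣ) : 𝔸) - 1‖ ≤ δ₁) (h₂ : ‖((Y * Z⁻¹ : 𝔸ˣ) : 𝔸) - 1‖ ≤ δ₂) :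
    ‖((X * Z⁻¹ : 𝔸ˣ) : 𝔸) - 1‖ ≤ δ₁ + δ₂ := by
  rw [show X * Z⁻¹ = (X * Y⁻¹) * (Y * Z⁻¹) by group]
  exact (norm_units_mul_sub_one_le ((U1 𝔸).mul_mem hX ((U1 𝔸).inv_mem hY))).trans (add_le_add h₁ h₂)

/-- **Swap estimate**: if the strip swept by `w` (no `κ`-letters) moved `j ≤ b` steps in direction `κ` from `q` has its
vertices in the plaquette-small region, `‖V(w ∪ [b e_κ]) · V([b e_κ] ∪ w)⁻¹ − 1‖ ≤ b·|w|·ε`. [cite: Balaban1989LargeFieldII, p.382] -/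
theorem norm_swap_le (hV : ∀ x κ, V x κ ∈ U1 𝔸) (hP : PlaqSmallOn A V ε) (κ : Fin d) (w : List (Letter d))
    (hw : ∀ l ∈ w, l.1 ≠ κ) (b : ℕ) (q : Site d) (hstrip : ∀ j : ℕ, j ≤ b → PathIn A (q + (j : ℤ) • e κ) w) :
    ‖((hol V q (w ++ seg κ (b : ℤ)) * (hol V q (seg κ (b : ℤ) ++ w))⁻¹ : 𝔸ˣ) : 𝔸) - 1‖ ≤ b * (w.length * ε) := by
  rw [hol_swap_eq_wideLadder]
  exact norm_hol_wideLadder_sub_one_le hV hP κ w hw b q hstrip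

/-- **Conjugated-segment estimate**: `‖V(u) · V([δ e_ν] ∪ u ∪ [−δ e_ν])⁻¹ − 1‖ ≤ δ·|u|·ε` when the strip swept by `u` moved
`j ≤ δ` steps in direction `ν` has its vertices in the plaquette-small region. [cite: Balaban1989LargeFieldII, p.382] -/
theorem norm_conj_seg_ratio_le (hV : ∀ x κ, V x κ ∈ U1 𝔸) (hP : PlaqSmallOn A V ε) (ν : Fin d) (u : List (Letter d))
    (hu : ∀ l ∈ u, l.1 ≠ ν) (δ : ℕ) (r : Site d) (hstrip : ∀ j : ℕ, j ≤ δ → PathIn A (r + (j : ℤ) • e ν) u) :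
    ‖((hol V r u * (hol V r (seg ν (δ : ℤ) ++ u ++ seg ν (-(δ : ℤ))))⁻¹ : 𝔸ˣ) : 𝔸) - 1‖ ≤ δ * (u.length * ε) := by
  rw [hol_conj_seg_ratio]
  exact norm_hol_wideLadder_sub_one_le hV hP ν u hu δ r hstrip

end Ratio

/-! ## §2 The interleaving lemma: `tw K a ∪ tw K b` against `tw K (a + b)` -/

section Interleave

/-- `restrict` is additive. [cite: Balaban1989LargeFieldI, p.196] -/
theorem restrict_add (ks : List (Fin d)) (u v : Site d) : restrict ks (u + v) = restrict ks u + restrict ks v := by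
  funext κ
  simp only [restrict, Pi.add_apply]
  split_ifs <;> simp

/-- `restrict` of a vector non-negative on the list is non-negative. [cite: Balaban1989LargeFieldI, p.196] -/
theorem restrict_nonneg {ks : List (Fin d)} {v : Site d} (hv : ∀ κ ∈ ks, 0 ≤ v κ) : 0 ≤ restrict ks v := fun κ => by
  simp only [restrict, Pi.zero_apply]
  split_ifs with h
  · exact hv κ h
  · exact le_rfl

/-- Segments add: `seg κ (p + q) = seg κ p ∪ seg κ q` for `p, q ≥ 0`. [cite: Balaban1989LargeFieldI, p.196] -/
theorem seg_add_of_nonneg (κ : Fin d) {p q : ℤ} (hp : 0 ≤ p) (hq : 0 ≤ q) : seg κ (p + q) = seg κ p ++ seg κ q := by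
  obtain ⟨a, rfl⟩ := Int.eq_ofNat_of_zero_le hp
  obtain ⟨b, rfl⟩ := Int.eq_ofNat_of_zero_le hq
  rw [show (a : ℤ) + b = ((a + b : ℕ) : ℤ) by push_cast; rfl, seg_natCast, seg_natCast, seg_natCast, List.replicate_add]

/-- Backward segments add: `seg κ (−(p + q)) = seg κ (−p) ∪ seg κ (−q)` for `p, q ≥ 0`. [cite: Balaban1989LargeFieldI, p.196] -/
theorem seg_neg_add_of_nonneg (κ : Fin d) (a b : ℕ) :
    seg κ (-((a : ℤ) + b)) = seg κ (-(a : ℤ)) ++ seg κ (-(b : ℤ)) := by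
  rw [show -((a : ℤ) + b) = -((a + b : ℕ) : ℤ) by push_cast; rfl, seg_neg_natCast, seg_neg_natCast, seg_neg_natCast,
    List.replicate_add]

variable {𝔸 : Type*} [NormedRing 𝔸] [NormOneClass 𝔸]
variable {A : Set (Site d)} {V : Site d → Fin d → 𝔸ˣ} {ε : ℝ}

/-- **The interleaving lemma.**  For a list of directions `K` without repetition and two vectors `a, b` with entries in
`[0, W]` on `K`: the staircase `tw K a` followed by the staircase `tw K b` and the single staircase `tw K (a + b)` (all from
`p`) differ in transport by `‖V(tw K a ∪ tw K b)·V(tw K (a+b))⁻¹ − 1‖ ≤ |K|²W²ε`, provided every site of the order box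
`[p, p + (a + b)|_K]` lies in the plaquette-small region `A` — one wide ladder (PART 1) per direction of `K`: the second
staircase's `κ`-segment is commuted past the lower directions of the first.  This is the surface behind the loops through two
consecutive trees of `T₀` (§4). [cite: Balaban1989LargeFieldII, p.382] -/
theorem norm_hol_tw_append_tw_le (hV : ∀ x κ, V x κ ∈ U1 𝔸) (hP : PlaqSmallOn A V ε) (hε : 0 ≤ ε) (W : ℕ) :
    ∀ (K : List (Fin d)), K.Nodup → ∀ (a b p : Site d),
      (∀ κ ∈ K, 0 ≤ a κ ∧ a κ ≤ W) → (∀ κ ∈ K, 0 ≤ b κ ∧ b κ ≤ W) →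
      (∀ z : Site d, p ≤ z → z ≤ p + restrict K (a + b) → z ∈ A) →
      ‖((hol V p (tw K a ++ tw K b) * (hol V p (tw K (a + b)))⁻¹ : 𝔸ˣ) : 𝔸) - 1‖ ≤
        (K.length : ℝ) ^ 2 * (W : ℝ) ^ 2 * ε
  | [], _, a, b, p, _, _, _ => by simp
  | κ :: K, hnd, a, b, p, ha, hb, hS => by
    have hκ : κ ∉ K := (List.nodup_cons.mp hnd).1
    have hK : K.Nodup := (List.nodup_cons.mp hnd).2
    have haκ := ha κ (by simp)
    have hbκ := hb κ (by simp)
    have haK : ∀ κ' ∈ K, 0 ≤ a κ' ∧ a κ' ≤ W := fun κ' h => ha κ' (List.mem_cons_of_mem κ h)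
    have hbK : ∀ κ' ∈ K, 0 ≤ b κ' ∧ b κ' ≤ W := fun κ' h => hb κ' (List.mem_cons_of_mem κ h)
    obtain ⟨α, hα⟩ := Int.eq_ofNat_of_zero_le haκ.1
    obtain ⟨β, hβ⟩ := Int.eq_ofNat_of_zero_le hbκ.1
    -- the three words: `S_α ∪ (tw K a ∪ S_β) ∪ tw K b`, `S_α ∪ (S_β ∪ tw K a) ∪ tw K b`, `(S_α ∪ S_β) ∪ tw K (a+b)`
    have e0 : tw (κ :: K) a ++ tw (κ :: K) b = seg κ (α : ℤ) ++ (tw K a ++ seg κ (β : ℤ)) ++ tw K b := by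
      rw [tw_cons, tw_cons, hα, hβ]; simp only [List.append_assoc]
    have e1 : seg κ (α : ℤ) ++ (seg κ (β : ℤ) ++ tw K a) ++ tw K b =
        (seg κ (α : ℤ) ++ seg κ (β : ℤ)) ++ (tw K a ++ tw K b) ++ [] := by simp only [List.append_assoc, List.append_nil]
    have e2 : tw (κ :: K) (a + b) = (seg κ (α : ℤ) ++ seg κ (β : ℤ)) ++ tw K (a + b) ++ [] := by
      rw [tw_cons, Pi.add_apply, hα, hβ, seg_add_of_nonneg κ (by positivity) (by positivity), List.append_nil]
    -- the box bookkeeping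
    have hbox : p + restrict (κ :: K) (a + b) = p + ((α : ℤ) • e κ + (β : ℤ) • e κ) + restrict K (a + b) := by
      rw [restrict_cons hκ, Pi.add_apply, hα, hβ, add_smul]; abel
    have hαβ0 : (0 : Site d) ≤ (α : ℤ) • e κ + (β : ℤ) • e κ :=
      add_nonneg (zsmul_e_nonneg (by positivity) κ) (zsmul_e_nonneg (by positivity) κ)
    have hresK : restrict K a ≤ restrict K (a + b) := by
      rw [restrict_add]; exact le_add_of_nonneg_right (restrict_nonneg fun κ' h => (hbK κ' h).1)
    -- step 1: the swap `tw K a ∪ S_β ↦ S_β ∪ tw K a` (a wide ladder of `β` rows over `tw K a`)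
    have hw : ∀ l ∈ tw K a, l.1 ≠ κ := fun l hl h => hκ (h ▸ fst_mem_of_mem_tw hl)
    have hstrip : ∀ j : ℕ, j ≤ β → PathIn A (p + disp (seg κ (α : ℤ)) + (j : ℤ) • e κ) (tw K a) := by
      intro j hj
      refine pathIn_tw K hK a (fun κ' h => (haK κ' h).1) _ fun z hz1 hz2 => hS z ?_ ?_
      · refine le_trans ?_ hz1
        rw [disp_seg, add_assoc]
        exact le_add_of_nonneg_right (add_nonneg (zsmul_e_nonneg (by positivity) κ) (zsmul_e_nonneg (by positivity) κ))
      · refine hz2.trans ?_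
        rw [hbox, disp_seg]
        intro κ'
        have h5 : restrict K a κ' ≤ restrict K (a + b) κ' := hresK κ'
        simp only [Pi.add_apply, zsmul_e_apply]
        split_ifs <;> omega
    have h1 := norm_swap_le hV hP κ (tw K a) hw β (p + disp (seg κ (α : ℤ))) hstrip
    have h1' : ‖((hol V p (seg κ (α : ℤ) ++ (tw K a ++ seg κ (β : ℤ)) ++ tw K b) *
        (hol V p (seg κ (α : ℤ) ++ (seg κ (β : ℤ) ++ tw K a) ++ tw K b))⁻¹ : 𝔸ˣ) : 𝔸) - 1‖ ≤ β * ((tw K a).length * ε) :=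
      norm_replace_le hV (by simp [disp_append, add_comm]) h1
    -- step 2: the induction hypothesis after `S_α ∪ S_β`
    have ih := norm_hol_tw_append_tw_le hV hP hε W K hK a b (p + disp (seg κ (α : ℤ) ++ seg κ (β : ℤ))) haK hbK
      fun z hz1 hz2 => hS z (le_trans (by rw [disp_append, disp_seg, disp_seg]; exact le_add_of_nonneg_right hαβ0) hz1)
        (hz2.trans (by rw [hbox, disp_append, disp_seg, disp_seg]))
    have h2' : ‖((hol V p ((seg κ (α : ℤ) ++ seg κ (β : ℤ)) ++ (tw K a ++ tw K b) ++ []) *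
        (hol V p ((seg κ (α : ℤ) ++ seg κ (β : ℤ)) ++ tw K (a + b) ++ []))⁻¹ : 𝔸ˣ) : 𝔸) - 1‖ ≤
          (K.length : ℝ) ^ 2 * (W : ℝ) ^ 2 * ε :=
      norm_replace_le hV (by rw [disp_append, disp_tw hK, disp_tw hK, disp_tw hK, restrict_add]) ih
    -- assembling
    rw [e0, e2]
    rw [e1] at h1'
    have htot := norm_ratio_trans (hol_mem hV _ _) (hol_mem hV _ _) h1' h2'
    refine htot.trans ?_
    -- arithmetic: `β ≤ W`, `|tw K a| ≤ |K| W`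
    have hβW : (β : ℝ) ≤ W := by have := hbκ.2; rw [hβ] at this; exact_mod_cast this
    have hlen : ((tw K a).length : ℝ) ≤ K.length * W := by
      have h := length_tw_le (ks := K) (v := a) (W := W) fun κ' hκ' => by
        have h0 := (haK κ' hκ').1; have hW := (haK κ' hκ').2
        have := Int.natAbs_of_nonneg h0; omega
      exact_mod_cast h
    have hKn : (0 : ℝ) ≤ K.length := Nat.cast_nonneg _
    have hWn : (0 : ℝ) ≤ W := Nat.cast_nonneg _
    have h3 : (β : ℝ) * ((tw K a).length * ε) ≤ W * ((K.length * W) * ε) :=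
      mul_le_mul hβW (mul_le_mul_of_nonneg_right hlen hε) (by positivity) hWn
    have h4 : 0 ≤ ((K.length : ℝ) + 1) * (W : ℝ) ^ 2 * ε := by positivity
    rw [List.length_cons]; push_cast
    calc (β : ℝ) * ((tw K a).length * ε) + (K.length : ℝ) ^ 2 * (W : ℝ) ^ 2 * ε
        ≤ W * ((K.length * W) * ε) + (K.length : ℝ) ^ 2 * (W : ℝ) ^ 2 * ε := by linarith [h3]
      _ ≤ ((K.length : ℝ) + 1) ^ 2 * (W : ℝ) ^ 2 * ε := by linarith [h4]

end Interleave

/-! ## §3 Word identities for the usual contours -/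

section Words

variable {n : ℕ}

/-- `restrict` over the full list of directions is the identity. [cite: Balaban1989LargeFieldI, p.196] -/
theorem restrict_finRange_reverse (v : Site (n + 3)) : restrict (List.finRange (n + 3)).reverse v = v := by
  funext κ
  exact restrict_apply_of_mem (List.mem_reverse.mpr (List.mem_finRange κ)) v

/-- Extending a usual contour in direction `1`: `treeWord (v + c e₁) = treeWord v ∪ [c e₁]` for `v₁, c ≥ 0` (the last segment
of B5 (1.7) is the `1`-segment). [cite: Balaban1989LargeFieldI, p.196] -/
theorem treeWord_add_zsmul_e0 {v : Site (n + 3)} {c : ℤ} (hv : 0 ≤ v i0) (hc : 0 ≤ c) :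
    treeWord (v + c • e i0) = treeWord v ++ seg i0 c := by
  have e1 : tw (highDirs n) (v + c • e i0) = tw (highDirs n) v := tw_congr fun κ hκ => by
    have : κ ≠ i0 := fun h => i0_not_mem_highDirs (h ▸ hκ)
    rw [Pi.add_apply, zsmul_e_apply, if_neg this, add_zero]
  rw [treeWord_eq, treeWord_eq, e1]
  simp only [Pi.add_apply, zsmul_e_apply, if_true, i1_ne_i0, if_false, add_zero, seg_add_of_nonneg i0 hv hc,
    List.append_assoc]

/-- The high part of a vector: `tw` over the full list of a vector supported on the high directions is its high staircase.
[cite: Balaban1989LargeFieldI, p.196] -/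
theorem tw_finRange_restrict_highDirs (b : Site (n + 3)) :
    tw (List.finRange (n + 3)).reverse (restrict (highDirs n) b) = tw (highDirs n) b := by
  rw [finRange_reverse_eq, tw_append, tw_cons, tw_cons, tw_nil, restrict_apply_of_not_mem i1_not_mem_highDirs,
    restrict_apply_of_not_mem i0_not_mem_highDirs, seg_zero, seg_zero, List.append_nil, List.append_nil,
    List.append_nil, tw_congr fun κ hκ => restrict_apply_of_mem hκ b]

end Words

/-! ## §4 The two-level comparison: the `T₀`-path into the inner layer against the merged contour -/

section TwoLevel

variable {n : ℕ} {𝔸 : Type*} [NormedRing 𝔸] [NormOneClass 𝔸]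
variable {lo hi lo' hi' lo'' hi'' : Site (n + 3)} {τ : ℤ} {W : ℕ} {V : Site (n + 3) → Fin (n + 3) → 𝔸ˣ} {ε : ℝ}

/-- **Two-level comparison, case `x′₁ ≦ a`** (both contours usual): `‖V(treeWord(y′ − y) ∪ Γ^{P₂}_{x′}) · V(Γ^{P₁}_{x′})⁻¹
− 1‖ ≤ d²W²ε` — after the common last `1`-segment is split off, the two staircases from `y` to `(a′₁, x′₂, …, x′_d)` lie in the
slab `y ≤ z ≤ x′, z₁ ≤ a′₁` of `P₁ ∖ P₃` and the interleaving lemma applies. [cite: Balaban1989LargeFieldI, p.196] -/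
theorem norm_levelChange_usual_le (hGo : Geom lo hi lo' hi' τ) (hGi : Geom lo' hi' lo'' hi'' τ)
    (hW : ∀ κ, hi κ - lo κ ≤ W) (hV : ∀ x κ, V x κ ∈ U1 𝔸) (hε : 0 ≤ ε)
    (hP : PlaqSmallOn (ann lo hi lo'' hi'') V ε) {x' : Site (n + 3)} (hx' : x' ∈ ann lo' hi' lo'' hi'')
    (hxτ : x' i0 ≤ τ) :
    ‖((hol V lo (treeWord (lo' - lo) ++ contour lo' hi' τ x') * (hol V lo (contour lo hi τ x'))⁻¹ : 𝔸ˣ) : 𝔸) - 1‖ ≤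
      ((n : ℝ) + 3) ^ 2 * (W : ℝ) ^ 2 * ε := by
  have hxb := mem_box_iff.mp hx'.1
  -- the vectors `a = y′ − y`, `b̃ = (x′ − y′) with the `1`-coordinate removed`, `β₀ = x′₁ − y′₁`
  set a : Site (n + 3) := lo' - lo with ha
  set bt : Site (n + 3) := x' - lo' - (x' i0 - lo' i0) • e i0 with hbt
  have hbt0 : bt i0 = 0 := by rw [hbt, Pi.sub_apply, Pi.sub_apply, zsmul_e_apply, if_pos rfl]; ring
  have hβ0 : 0 ≤ x' i0 - lo' i0 := by linarith [(hxb i0).1]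
  have haW : ∀ κ ∈ (List.finRange (n + 3)).reverse, 0 ≤ a κ ∧ a κ ≤ W := fun κ _ => by
    have h1 := hGo.lo_lt κ; have h2 := hGo.lt_hi κ; have h3 := (hxb κ).1; have h4 := (hxb κ).2; have h5 := hW κ
    simp only [ha, Pi.sub_apply]; constructor <;> omega
  have hbW : ∀ κ ∈ (List.finRange (n + 3)).reverse, 0 ≤ bt κ ∧ bt κ ≤ W := fun κ _ => by
    by_cases h0 : κ = i0
    · rw [h0, hbt0]; exact ⟨le_rfl, by positivity⟩
    · have h1 := hGo.lo_lt κ; have h2 := hGo.lt_hi κ; have h3 := (hxb κ).1; have h4 := (hxb κ).2; have h5 := hW κ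
      have : bt κ = x' κ - lo' κ := by rw [hbt, Pi.sub_apply, Pi.sub_apply, zsmul_e_apply, if_neg h0, sub_zero]
      rw [this]; constructor <;> omega
  -- the words
  have eA : contour lo' hi' τ x' = treeWord bt ++ seg i0 (x' i0 - lo' i0) := by
    rw [contour_of_le hxτ, ← treeWord_add_zsmul_e0 (le_of_eq hbt0.symm) hβ0, hbt, sub_add_cancel]
  have hab0 : 0 ≤ (a + bt) i0 := by rw [Pi.add_apply, hbt0, add_zero]; exact (haW i0 (by simp)).1
  have eB : contour lo hi τ x' = treeWord (a + bt) ++ seg i0 (x' i0 - lo' i0) := by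
    rw [contour_of_le hxτ, ← treeWord_add_zsmul_e0 hab0 hβ0, ha, hbt]
    congr 1; abel
  have eA' : treeWord (lo' - lo) ++ contour lo' hi' τ x' =
      [] ++ (tw (List.finRange (n + 3)).reverse a ++ tw (List.finRange (n + 3)).reverse bt) ++ seg i0 (x' i0 - lo' i0) := by
    rw [eA, ← ha, treeWord_eq_tw, treeWord_eq_tw, List.nil_append, List.append_assoc]
  have eB' : contour lo hi τ x' = [] ++ tw (List.finRange (n + 3)).reverse (a + bt) ++ seg i0 (x' i0 - lo' i0) := by
    rw [eB, treeWord_eq_tw, List.nil_append]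
  -- the slab: every `z` with `y ≤ z ≤ y + a + b̃ = (a′₁, x′₂, …)` is in `P₁ ∖ P₃`
  have hend0 : (lo + restrict (List.finRange (n + 3)).reverse (a + bt)) i0 = lo' i0 := by
    rw [restrict_finRange_reverse, Pi.add_apply, Pi.add_apply, hbt0, ha, Pi.sub_apply]; ring
  have hend : ∀ κ, κ ≠ i0 → (lo + restrict (List.finRange (n + 3)).reverse (a + bt)) κ = x' κ := by
    intro κ h0
    rw [restrict_finRange_reverse, Pi.add_apply, Pi.add_apply, ha, hbt, Pi.sub_apply, Pi.sub_apply, Pi.sub_apply,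
      zsmul_e_apply, if_neg h0]
    ring
  have hbox : ∀ z : Site (n + 3), lo ≤ z → z ≤ lo + restrict (List.finRange (n + 3)).reverse (a + bt) →
      z ∈ ann lo hi lo'' hi'' := by
    intro z hz1 hz2
    have hz0 : z i0 ≤ lo' i0 := by have h := hz2 i0; rwa [hend0] at h
    refine ⟨mem_box_iff.mpr fun κ => ⟨hz1 κ, ?_⟩, not_mem_box_of_lt i0 (lt_of_le_of_lt hz0 (hGi.lo_lt i0))⟩
    by_cases h0 : κ = i0
    · rw [h0]
      have h1 := hGo.lt_hi i0; have h3 := (hxb i0).1; have h4 := (hxb i0).2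
      omega
    · have h : z κ ≤ x' κ := by have h := hz2 κ; rwa [hend κ h0] at h
      have h1 := hGo.lt_hi κ; have h4 := (hxb κ).2
      omega
  have key := norm_hol_tw_append_tw_le hV hP hε W _ finRange_reverse_nodup a bt lo haW hbW hbox
  rw [List.length_reverse, List.length_finRange] at key
  simp only [Nat.cast_add, Nat.cast_ofNat] at key
  have hrep := norm_replace_le hV (p := lo) (w₁ := []) (w₂ := seg i0 (x' i0 - lo' i0))
    (u := tw (List.finRange (n + 3)).reverse a ++ tw (List.finRange (n + 3)).reverse bt)
    (u' := tw (List.finRange (n + 3)).reverse (a + bt)) (δ := ((n : ℝ) + 3) ^ 2 * (W : ℝ) ^ 2 * ε)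
    (by rw [disp_append, disp_tw finRange_reverse_nodup, disp_tw finRange_reverse_nodup,
      disp_tw finRange_reverse_nodup, restrict_add]) (by rw [disp_nil, add_zero]; exact key)
  rw [eA', eB']
  exact hrep

end TwoLevel

end Literature.MathematicalPhysics.QuantumFieldTheory.Balaban1983to89.B16Ineq382
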